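import Mathlib
import HarnessLib

/-!
# The unbounded denominators theorem (Calegari–Dimitrov–Tang) — named fact

Family `lang`, layer `Literature/NumberTheory/Automorphic`. Consumer: route
`Summits/Langlands/Langlands/Theses/CapacityClassicality.lean` (the planned layer-2 child
`CongruenceUpgrade` of crux `IntegralOverconvergentIsCongruence`, item stmt-Langlands-8457, whose
grounding note asks for this fact; the route's DEFINITION REQUESTS § lists "CDT Thm 1 (typable now over
Mathlib's finite-index ModularForm)").

F. Calegari, V. Dimitrov, Y. Tang, *The unbounded denominators conjecture*, J. Amer. Math. Soc. 38
(2025), 627–702 (arXiv:2109.09040), Theorem 1 (p. 3 of the arXiv version), verbatim: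

> **Theorem 1 (Unbounded Denominators Conjecture).** Let `N` be any positive integer, and let
> `f(τ) ∈ ℤ⟦q^{1/N}⟧` for `q = exp(πiτ)` be a holomorphic function on the upper half plane. Suppose
> there exists an integer `k` and a finite index subgroup `Γ ⊂ SL₂(ℤ)` such that
> `f((aτ+b)/(cτ+d)) = (cτ+d)ᵏ f(τ)` for all `(a b; c d) ∈ Γ`, and suppose that `f(τ)` is meromorphic
> at the cusps, that is, locally extends to a meromorphic function near every cusp in the
> compactification of `ℍ/Γ`. Then `f(τ)` is a modular form for a congruence subgroup of `SL₂(ℤ)`.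

and, loc. cit. p. 3: "The corresponding statement remains true if one replaces `ℚ` by any number
field", made precise in Remark 58 (arXiv numbering; the remark closing the proof of Theorem 1),
verbatim: "Our proof for Theorem 1 generalizes in the obvious way to establish that a modular form
`f(τ)` having a Fourier expansion in `ℤ̄⟦q^{1/N}⟧` (algebraic integer Fourier coefficients) at one
cusp, and meromorphic at all cusps, is a modular form for a congruence subgroup of `SL₂(ℤ)`."
(Remark 59 derives the same from Theorem 1 by a trace argument of J. Voight.)

## Rendering and faithfulness

* We vendor the HOLOMORPHIC-AT-THE-CUSPS case, which is the one Mathlib can state: `f` is a Mathlib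
  `ModularForm Γ k` for `Γ ≤ SL(2, ℤ)` of finite index (viewed in `GL(2, ℝ)⁺` through the standard
  coercion), i.e. holomorphic on `ℍ`, weight-`k` invariant under `Γ`, and bounded at every cusp of
  `Γ`. This is a special case of the printed hypothesis (bounded ⇒ meromorphic at the cusps), so the
  `Prop` below is implied by the printed theorem and is never stronger than it.
* "`f ∈ ℤ⟦q^{1/N}⟧`, `q = e^{πiτ}`": we ask that for some positive integer `h` which is a strict period
  of `Γ` (so that Mathlib's `UpperHalfPlane.qExpansion h f`, the expansion of `f` in
  `𝕢 h τ = e^{2πiτ/h}`, converges to `f` — `UpperHalfPlane.hasSum_qExpansion`) every coefficient of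
  `qExpansion h f` is a rational integer. Since `e^{2πiτ/h} = (e^{πiτ/h})²`, such an `f` lies in
  `ℤ⟦q^{1/h}⟧` with `q = e^{πiτ}`: again a special case of the printed hypothesis (`N = h`).
* "is a modular form for a congruence subgroup": there is a congruence subgroup `Γ' ≤ SL(2, ℤ)`
  (Mathlib `CongruenceSubgroup.IsCongruenceSubgroup Γ' : ∃ N ≠ 0, Γ(N) ≤ Γ'`) and a Mathlib
  `ModularForm Γ' k` with the same underlying function. The weight is kept equal to `k` (for `f ≠ 0`
  the weight of a non-zero form on a finite-index group is determined by the function; for `f = 0`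
  the conclusion is trivial in any weight).
* `…_algInt` is the algebraic-integer-coefficient version of Remark 58/59 (`IsIntegral ℤ` of every
  coefficient of `qExpansion h f`), again in the holomorphic-at-the-cusps case; this is the form the
  consumer route uses (`O_E`-integral coefficients).
* Nothing else (vector-valued version, Theorem 2's classification of integral Puiseux branches over
  `Y(2)`) is vendored.

## References

* [CalegariDimitrovTang2025] F. Calegari, V. Dimitrov, Y. Tang, The unbounded denominators
  conjecture, J. Amer. Math. Soc. 38 (2025), no. 3, 627–702; arXiv:2109.09040, Theorem 1.
-/

noncomputable section

namespace Literature.NumberTheory.Automorphic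

open scoped MatrixGroups
open UpperHalfPlane CongruenceSubgroup

/-- **Unbounded denominators theorem** (Calegari–Dimitrov–Tang), holomorphic-at-the-cusps case, as a
named fact: a modular form `f` of integer weight `k` for a finite-index subgroup `Γ ≤ SL(2, ℤ)`
(holomorphic on `ℍ` and bounded at all cusps — Mathlib's `ModularForm`), whose `q`-expansion in
`e^{2πiτ/h}` for some positive integer strict period `h` of `Γ` has rational-integer coefficients, is a
modular form (of the same weight) for some congruence subgroup of `SL(2, ℤ)`. Grounds the planned
`CongruenceUpgrade` step of `Summit.Langlands.Langlands.Theses.CapacityClassicality.IntegralOverconvergentIsCongruence`.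
Consumers take `(h : CalegariDimitrovTang2025_unboundedDenominators)`.
[cite: CalegariDimitrovTang2025, Theorem 1] -/
def CalegariDimitrovTang2025_unboundedDenominators : Prop :=
  ∀ (Γ : Subgroup SL(2, ℤ)) [Γ.FiniteIndex] (k : ℤ)
    (f : ModularForm (Γ : Subgroup (GL (Fin 2) ℝ)) k) (h : ℕ), 0 < h →
    ((h : ℝ) ∈ (Γ : Subgroup (GL (Fin 2) ℝ)).strictPeriods) →
    (∀ n : ℕ, ∃ z : ℤ, PowerSeries.coeff n (qExpansion (h : ℝ) f) = (z : ℂ)) →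
    ∃ (Γ' : Subgroup SL(2, ℤ)) (g : ModularForm (Γ' : Subgroup (GL (Fin 2) ℝ)) k),
      IsCongruenceSubgroup Γ' ∧ (g : ℍ → ℂ) = f

/-- **Unbounded denominators theorem, algebraic-integer coefficients** (Calegari–Dimitrov–Tang,
Remark 58, with Voight's trace argument of Remark 59), holomorphic-at-the-cusps case, as a named fact:
as above with "rational-integer coefficients" replaced by "algebraic-integer coefficients"
(`IsIntegral ℤ`). Consumers take `(h : CalegariDimitrovTang2025_unboundedDenominators_algInt)`.
[cite: CalegariDimitrovTang2025, Remark 58 and Remark 59 (arXiv:2109.09040 numbering)] -/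
def CalegariDimitrovTang2025_unboundedDenominators_algInt : Prop :=
  ∀ (Γ : Subgroup SL(2, ℤ)) [Γ.FiniteIndex] (k : ℤ)
    (f : ModularForm (Γ : Subgroup (GL (Fin 2) ℝ)) k) (h : ℕ), 0 < h →
    ((h : ℝ) ∈ (Γ : Subgroup (GL (Fin 2) ℝ)).strictPeriods) →
    (∀ n : ℕ, IsIntegral ℤ (PowerSeries.coeff n (qExpansion (h : ℝ) f))) →
    ∃ (Γ' : Subgroup SL(2, ℤ)) (g : ModularForm (Γ' : Subgroup (GL (Fin 2) ℝ)) k),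
      IsCongruenceSubgroup Γ' ∧ (g : ℍ → ℂ) = f

/-- The algebraic-integer version implies the rational-integer version (an integer is an algebraic
integer: `isIntegral_algebraMap`). [cite: CalegariDimitrovTang2025, Theorem 1 and Remark 58] -/
theorem CalegariDimitrovTang2025_unboundedDenominators_of_algInt
    (h : CalegariDimitrovTang2025_unboundedDenominators_algInt) :
    CalegariDimitrovTang2025_unboundedDenominators := by
  intro Γ _ k f n hn hper hint
  refine h Γ k f n hn hper fun m ↦ ?_
  obtain ⟨z, hz⟩ := hint m
  rw [hz]
  exact isIntegral_algebraMap (R := ℤ) (A := ℂ) (x := z)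

/-- Sanity: the fact applies in particular to level-one forms with integral `q`-expansion
(`Γ = SL(2, ℤ)` has finite index in itself and strict period `1`), where the conclusion is of course
trivial — recorded only to exercise the binders. [cite: CalegariDimitrovTang2025, Theorem 1] -/
theorem CalegariDimitrovTang2025_unboundedDenominators.level_one
    (hCDT : CalegariDimitrovTang2025_unboundedDenominators) (k : ℤ)
    (f : ModularForm ((⊤ : Subgroup SL(2, ℤ)) : Subgroup (GL (Fin 2) ℝ)) k)
    (h1 : ((1 : ℕ) : ℝ) ∈ ((⊤ : Subgroup SL(2, ℤ)) : Subgroup (GL (Fin 2) ℝ)).strictPeriods)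
    (hint : ∀ n : ℕ, ∃ z : ℤ, PowerSeries.coeff n (qExpansion ((1 : ℕ) : ℝ) f) = (z : ℂ)) :
    ∃ (Γ' : Subgroup SL(2, ℤ)) (g : ModularForm (Γ' : Subgroup (GL (Fin 2) ℝ)) k),
      IsCongruenceSubgroup Γ' ∧ (g : ℍ → ℂ) = f :=
  hCDT ⊤ k f 1 Nat.one_pos h1 hint

/-!
## The cases provable today (non-positive weight) and the reduction to positive weight

The theorems below record, sorry-free, the part of
`CalegariDimitrovTang2025_unboundedDenominators` that present-day Mathlib proves, and isolate what
remains (added 2026-08-15 by the `provefact` unit for this fact; no new definitions, no new named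
facts — D-0026):

* `…conclusion_of_isCongruenceSubgroup` — if the level `Γ` is already a congruence subgroup the
  conclusion is tautological (`g = f`).
* `…conclusion_of_weight_neg` — in weight `k < 0` every modular form on a finite-index subgroup of
  `SL(2, ℤ)` vanishes (Mathlib `ModularForm.isZero_of_neg_weight`, via the norm map down to level
  one and the level-one vanishing in negative weight), so the conclusion holds with `Γ' = Γ(1)`,
  `g = 0`.
* `…conclusion_of_weight_zero` — in weight `0` every such form is constant (Mathlib
  `ModularForm.eq_const_of_weight_zero`), so the conclusion holds with `Γ' = Γ(1)`, `g = const`.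
* `…of_weight_nonpos` — the fact restricted to weights `k ≤ 0`, with exactly the fact's binders.
* `CalegariDimitrovTang2025_unboundedDenominators.of_pos_weight_case` — the full fact follows from
  its restriction to weights `k ≥ 1`. That restriction is the theorem proper: Calegari–Dimitrov–Tang
  prove it (op. cit. §6.3) from their arithmetic holonomy bound (Theorem 3 / Corollary 5), the
  reduction Proposition 15 (algebraic modular curves finite étale over `Y(2)`, Fuchsian ODE with
  trivial local monodromies), the Wohlfahrt-level algebra of noncongruence forms (§4: Theorem 25,
  Proposition 26, Lemma 30 — using the congruence subgroup property of `SL₂(ℤ[1/p])` and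
  `[Γ(2) : Γ(2N)] ≫ N³`), the exact conformal radius `16^{1/N} (1 + ζ(3)/(2N³) + …)` of the
  uniformization `D(0,1) → ℂ ∖ μ_N` (§5) and the Nevanlinna-theoretic mean-growth bound Theorem 52
  (§6); none of these ingredients exists in Mathlib at present (arXiv:2109.09040 numbering).
-/

/-- Trivial sub-case of the unbounded denominators theorem: if the level `Γ ≤ SL(2, ℤ)` is itself a
congruence subgroup, a weight-`k` modular form on `Γ` is (tautologically) a weight-`k` modular form
on a congruence subgroup. [cite: CalegariDimitrovTang2025, Theorem 1] -/
theorem CalegariDimitrovTang2025_unboundedDenominators.conclusion_of_isCongruenceSubgroup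
    (Γ : Subgroup SL(2, ℤ)) (k : ℤ) (f : ModularForm (Γ : Subgroup (GL (Fin 2) ℝ)) k)
    (hΓ : IsCongruenceSubgroup Γ) :
    ∃ (Γ' : Subgroup SL(2, ℤ)) (g : ModularForm (Γ' : Subgroup (GL (Fin 2) ℝ)) k),
      IsCongruenceSubgroup Γ' ∧ (g : ℍ → ℂ) = f :=
  ⟨Γ, f, hΓ, rfl⟩

/-- Negative-weight sub-case of the unbounded denominators theorem: a modular form of weight
`k < 0` on a finite-index subgroup `Γ ≤ SL(2, ℤ)` (holomorphic at the cusps) is zero — Mathlib's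
`ModularForm.isZero_of_neg_weight`, proved through the norm map down to level one — hence it is the
zero form of weight `k` on the congruence subgroup `Γ(1)`. No integrality hypothesis is needed.
[cite: CalegariDimitrovTang2025, Theorem 1] -/
theorem CalegariDimitrovTang2025_unboundedDenominators.conclusion_of_weight_neg
    (Γ : Subgroup SL(2, ℤ)) [Γ.FiniteIndex] {k : ℤ} (hk : k < 0)
    (f : ModularForm (Γ : Subgroup (GL (Fin 2) ℝ)) k) :
    ∃ (Γ' : Subgroup SL(2, ℤ)) (g : ModularForm (Γ' : Subgroup (GL (Fin 2) ℝ)) k),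
      IsCongruenceSubgroup Γ' ∧ (g : ℍ → ℂ) = f := by
  refine ⟨Gamma 1, 0, Gamma_is_cong_sub 1, ?_⟩
  rw [ModularForm.isZero_of_neg_weight hk f, ModularForm.coe_zero, ModularForm.coe_zero]

/-- Weight-zero sub-case of the unbounded denominators theorem: a modular form of weight `0` on a
finite-index subgroup `Γ ≤ SL(2, ℤ)` (holomorphic at the cusps) is constant — Mathlib's
`ModularForm.eq_const_of_weight_zero` — hence it is a constant modular form of weight `0` on the
congruence subgroup `Γ(1)`. No integrality hypothesis is needed.
[cite: CalegariDimitrovTang2025, Theorem 1] -/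
theorem CalegariDimitrovTang2025_unboundedDenominators.conclusion_of_weight_zero
    (Γ : Subgroup SL(2, ℤ)) [Γ.FiniteIndex]
    (f : ModularForm (Γ : Subgroup (GL (Fin 2) ℝ)) 0) :
    ∃ (Γ' : Subgroup SL(2, ℤ)) (g : ModularForm (Γ' : Subgroup (GL (Fin 2) ℝ)) 0),
      IsCongruenceSubgroup Γ' ∧ (g : ℍ → ℂ) = f := by
  obtain ⟨c, hc⟩ := ModularForm.eq_const_of_weight_zero f
  refine ⟨Gamma 1, ModularForm.const c, Gamma_is_cong_sub 1, ?_⟩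
  rw [hc, ModularForm.coe_const]

/-- **Unbounded denominators theorem in non-positive weight** (the part of
`CalegariDimitrovTang2025_unboundedDenominators` that Mathlib proves today), with exactly the fact's
binders plus `k ≤ 0`: in weight `k ≤ 0` a modular form on a finite-index `Γ ≤ SL(2, ℤ)` is zero
(`k < 0`) or constant (`k = 0`), hence modular of weight `k` for `Γ(1)`; the `q`-expansion
hypotheses are not used. [cite: CalegariDimitrovTang2025, Theorem 1] -/
theorem CalegariDimitrovTang2025_unboundedDenominators.of_weight_nonpos
    (Γ : Subgroup SL(2, ℤ)) [Γ.FiniteIndex] (k : ℤ) (hk : k ≤ 0)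
    (f : ModularForm (Γ : Subgroup (GL (Fin 2) ℝ)) k) (h : ℕ) (_hh : 0 < h)
    (_hper : (h : ℝ) ∈ (Γ : Subgroup (GL (Fin 2) ℝ)).strictPeriods)
    (_hint : ∀ n : ℕ, ∃ z : ℤ, PowerSeries.coeff n (qExpansion (h : ℝ) f) = (z : ℂ)) :
    ∃ (Γ' : Subgroup SL(2, ℤ)) (g : ModularForm (Γ' : Subgroup (GL (Fin 2) ℝ)) k),
      IsCongruenceSubgroup Γ' ∧ (g : ℍ → ℂ) = f := by
  obtain rfl | hk' := hk.eq_or_lt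
  · exact CalegariDimitrovTang2025_unboundedDenominators.conclusion_of_weight_zero Γ f
  · exact CalegariDimitrovTang2025_unboundedDenominators.conclusion_of_weight_neg Γ hk' f

/-- **Reduction to positive weight.** The named fact
`CalegariDimitrovTang2025_unboundedDenominators` follows from its restriction to weights `k ≥ 1`
(the non-positive weights being settled by `…of_weight_nonpos`). The positive-weight restriction is
the actual content of Calegari–Dimitrov–Tang's Theorem 1 (op. cit. §6.3); it is taken here as the
inline hypothesis `hpos` — deliberately NOT a new named fact — so that a future proof of the
positive-weight case closes the fact through this lemma.
[cite: CalegariDimitrovTang2025, Theorem 1 and §6.3] -/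
theorem CalegariDimitrovTang2025_unboundedDenominators.of_pos_weight_case
    (hpos : ∀ (Γ : Subgroup SL(2, ℤ)) [Γ.FiniteIndex] (k : ℤ), 1 ≤ k →
      ∀ (f : ModularForm (Γ : Subgroup (GL (Fin 2) ℝ)) k) (h : ℕ), 0 < h →
      ((h : ℝ) ∈ (Γ : Subgroup (GL (Fin 2) ℝ)).strictPeriods) →
      (∀ n : ℕ, ∃ z : ℤ, PowerSeries.coeff n (qExpansion (h : ℝ) f) = (z : ℂ)) →
      ∃ (Γ' : Subgroup SL(2, ℤ)) (g : ModularForm (Γ' : Subgroup (GL (Fin 2) ℝ)) k),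
        IsCongruenceSubgroup Γ' ∧ (g : ℍ → ℂ) = f) :
    CalegariDimitrovTang2025_unboundedDenominators := by
  intro Γ _ k f h hh hper hint
  rcases le_or_gt k 0 with hk | hk
  · exact CalegariDimitrovTang2025_unboundedDenominators.of_weight_nonpos Γ k hk f h hh hper hint
  · exact hpos Γ k hk f h hh hper hint

/-!
## The algebraic-integer version `…_algInt`: review, and Remark 59 formalized around its inputs

Added 2026-08-15 by the review seat for the fact
`CalegariDimitrovTang2025_unboundedDenominators_algInt` (no new definitions, no new named facts —
D-0026), with arXiv:2109.09040 open at Theorem 1 (p. 3) and at Remarks 58–59 (the two remarks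
closing §6.3 "Proof of Theorem 1").

* The statement is FAITHFUL. Remark 58 as printed: "a modular form `f(τ)` having a Fourier
  expansion in `ℤ̄⟦q^{1/N}⟧` (algebraic integer Fourier coefficients) at one cusp, and meromorphic
  at all cusps, is a modular form for a congruence subgroup of `SL₂(ℤ)`"; `…_algInt` is its
  holomorphic-at-the-cusps special case (`IsIntegral ℤ` coefficientwise for `qExpansion h f`, `h` a
  positive strict period of the level). It is a published theorem (J. Amer. Math. Soc. 38 (2025)),
  not an open problem, and it is not a piece of a decomposition of
  `CalegariDimitrovTang2025_unboundedDenominators` but the printed generalization — the STRONGER of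
  the two facts (`CalegariDimitrovTang2025_unboundedDenominators_of_algInt`).
* Its printed proofs. Remark 58: rerun §§2–6 (arithmetic holonomy bound, the Wohlfahrt-level
  algebras `R_N ⊇ M_N`, the conformal radius of `ℂ ∖ μ_N`, the Nevanlinna growth bound) over a
  number field `K`. Remark 59 (J. Voight): (i) since `f` is a modular form, `f ∈ O_K⟦q^{1/N}⟧` for
  one number field `K`; (ii) `Gal(ℚ̄/ℚ)` acts on `q`-expansions of modular forms, so for a
  `ℤ`-basis `α₁, …, α_d` of `O_K` the traces `fᵢ = Tr_{K/ℚ}(αᵢ f) ∈ ℤ⟦q^{1/N}⟧` are weight-`k`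
  modular forms on finite-index subgroups, and `f` is a `K`-linear combination of them;
  (iii) Theorem 1 makes each `fᵢ` congruence; (iv) `f` is then modular for the congruence
  subgroup `Γ₁ ∩ ⋯ ∩ Γ_d`. Inputs (i) and (ii) belong to the algebraic theory of (noncongruence)
  modular curves and (iii) is the base fact — none of the three is available in Mathlib today, so
  the fact is not dischargeable now. Everything else in Remark 59 is PROVED below, with (i), (ii)
  and Theorem 1 entering as explicit hypotheses (inline, deliberately NOT named facts):
  - `CalegariDimitrovTang2025_unboundedDenominators.conclusion_linearCombination` — step (iv) from
    the base fact: finite `ℂ`-combinations of integral forms on finite-index levels are modular on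
    a congruence subgroup (restriction of level, `Γ(MN) ≤ Γ(M) ∩ Γ(N)`);
  - `…_algInt.descent_of_galois` — the trace decomposition of step (ii)
    from inputs (i) `hA` and (ii) `hB`: `fᵢ := Σ_τ τ(αᵢ) f^τ` on the intersection of the levels of
    the conjugates has coefficients `Tr(αᵢ bₙ) ∈ ℤ`, and `f = f^{σ₀} = Σᵢ cᵢ fᵢ` with `c` solving
    `Σᵢ cᵢ τ(αᵢ) = δ_{τ,σ₀}` (solvable as `det(τⱼ(αᵢ))² = disc K ≠ 0`; the `q`-expansion determines
    the form by `hasSum_qExpansion`);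
  - `…_algInt.of_unboundedDenominators_of_descent` and `…_algInt.of_unboundedDenominators_of_galois`
    — Remark 59 assembled: base fact + (i) + (ii) ⇒ `…_algInt`.
* As for the base fact, the weights `k ≤ 0` are settled outright (`…_algInt.of_weight_nonpos`:
  such forms are `0` or constant) and the fact reduces to weights `k ≥ 1`
  (`…_algInt.of_pos_weight_case`).
-/

/-- The intersection of two congruence subgroups of `SL(2, ℤ)` is a congruence subgroup:
`Γ(M N) ≤ Γ(M) ⊓ Γ(N)`. [folklore] -/
private theorem isCongruenceSubgroup_inf {Γ₁ Γ₂ : Subgroup SL(2, ℤ)}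
    (h₁ : IsCongruenceSubgroup Γ₁) (h₂ : IsCongruenceSubgroup Γ₂) :
    IsCongruenceSubgroup (Γ₁ ⊓ Γ₂) := by
  obtain ⟨M, hM, hM'⟩ := h₁
  obtain ⟨N, hN, hN'⟩ := h₂
  refine ⟨M * N, mul_ne_zero hM hN, fun A hA ↦ ?_⟩
  rw [Gamma_mem] at hA
  obtain ⟨h00, h01, h10, h11⟩ := hA
  have hred : ∀ {L : ℕ}, L ∣ M * N → A ∈ Gamma L := by
    intro L hL
    have c00 := congrArg (ZMod.castHom hL (ZMod L)) h00
    have c01 := congrArg (ZMod.castHom hL (ZMod L)) h01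
    have c10 := congrArg (ZMod.castHom hL (ZMod L)) h10
    have c11 := congrArg (ZMod.castHom hL (ZMod L)) h11
    rw [map_intCast, map_one] at c00 c11
    rw [map_intCast, map_zero] at c01 c10
    exact Gamma_mem.mpr ⟨c00, c01, c10, c11⟩
  exact ⟨hM' (hred (dvd_mul_right M N)), hN' (hred (dvd_mul_left N M))⟩

/-- Restriction of level: a weight-`k` modular form on `Γ ≤ GL(2, ℝ)` is a weight-`k` modular
form on every subgroup `Γ' ≤ Γ` (cusps of `Γ'` are cusps of `Γ`, `IsCusp.mono`), with the same
underlying function. [folklore] -/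
private theorem exists_modularForm_of_le {Γ Γ' : Subgroup (GL (Fin 2) ℝ)} (hle : Γ' ≤ Γ) (k : ℤ)
    (f : ModularForm Γ k) : ∃ g : ModularForm Γ' k, (g : ℍ → ℂ) = f :=
  ⟨{ toFun := f
     slash_action_eq' := fun γ hγ ↦ f.slash_action_eq' γ (hle hγ)
     holo' := f.holo'
     bdd_at_cusps' := fun hc ↦ f.bdd_at_cusps' (hc.mono hle) }, rfl⟩

/-- **Voight's assembly step (Remark 59), proved from the base fact.** Assuming the unbounded
denominators theorem `CalegariDimitrovTang2025_unboundedDenominators`, every finite `ℂ`-linear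
combination `Σ_{i ∈ s} cᵢ • fᵢ` of weight-`k` modular forms `fᵢ` on finite-index subgroups
`Γᵢ ≤ SL(2, ℤ)`, each with rational-integer `q`-expansion coefficients at some positive strict
period `hᵢ` of `Γᵢ`, is (the underlying function of) a weight-`k` modular form on a congruence
subgroup:
Theorem 1 puts each `fᵢ` on a congruence subgroup `Γᵢ'`, and the combination lives on the congruence
subgroup `⋂ᵢ Γᵢ'` ("`f(τ)`, being a `K`-linear combination of `f₁, …, f_d`, is modular for the
congruence subgroup `Γ₁ ∩ ⋯ ∩ Γ_d`", loc. cit.).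
[cite: CalegariDimitrovTang2025, Remark 59 (arXiv:2109.09040 numbering)] -/
theorem CalegariDimitrovTang2025_unboundedDenominators.conclusion_linearCombination
    (hCDT : CalegariDimitrovTang2025_unboundedDenominators) {ι : Type*} (s : Finset ι) (k : ℤ)
    (c : ι → ℂ) (Γ : ι → Subgroup SL(2, ℤ)) [∀ i, (Γ i).FiniteIndex]
    (f : ∀ i, ModularForm ((Γ i : Subgroup SL(2, ℤ)) : Subgroup (GL (Fin 2) ℝ)) k) (h : ι → ℕ)
    (hh : ∀ i ∈ s, 0 < h i)
    (hper : ∀ i ∈ s,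
      ((h i : ℕ) : ℝ) ∈ ((Γ i : Subgroup SL(2, ℤ)) : Subgroup (GL (Fin 2) ℝ)).strictPeriods)
    (hint : ∀ i ∈ s, ∀ n : ℕ, ∃ z : ℤ, PowerSeries.coeff n (qExpansion (h i : ℝ) (f i)) = (z : ℂ)) :
    ∃ (Γ' : Subgroup SL(2, ℤ)) (g : ModularForm (Γ' : Subgroup (GL (Fin 2) ℝ)) k),
      IsCongruenceSubgroup Γ' ∧ (g : ℍ → ℂ) = ∑ i ∈ s, c i • (f i : ℍ → ℂ) := by
  classical
  induction s using Finset.induction_on with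
  | empty => exact ⟨Gamma 1, 0, Gamma_is_cong_sub 1, by simp⟩
  | insert a s ha ih =>
    obtain ⟨Γ₁, g₁, hΓ₁, hg₁⟩ := ih (fun i hi ↦ hh i (Finset.mem_insert_of_mem hi))
      (fun i hi ↦ hper i (Finset.mem_insert_of_mem hi))
      (fun i hi ↦ hint i (Finset.mem_insert_of_mem hi))
    obtain ⟨Γ₂, g₂, hΓ₂, hg₂⟩ := hCDT (Γ a) k (f a) (h a) (hh a (Finset.mem_insert_self a s))
      (hper a (Finset.mem_insert_self a s)) (hint a (Finset.mem_insert_self a s))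
    have hle₁ : ((Γ₁ ⊓ Γ₂ : Subgroup SL(2, ℤ)) : Subgroup (GL (Fin 2) ℝ)) ≤
        (Γ₁ : Subgroup (GL (Fin 2) ℝ)) := Subgroup.map_mono inf_le_left
    have hle₂ : ((Γ₁ ⊓ Γ₂ : Subgroup SL(2, ℤ)) : Subgroup (GL (Fin 2) ℝ)) ≤
        (Γ₂ : Subgroup (GL (Fin 2) ℝ)) := Subgroup.map_mono inf_le_right
    obtain ⟨G₁, hG₁⟩ := exists_modularForm_of_le hle₁ k g₁
    obtain ⟨G₂, hG₂⟩ := exists_modularForm_of_le hle₂ k g₂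
    refine ⟨Γ₁ ⊓ Γ₂, c a • G₂ + G₁, isCongruenceSubgroup_inf hΓ₁ hΓ₂, ?_⟩
    rw [Finset.sum_insert ha, ModularForm.coe_add, ModularForm.IsGLPos.coe_smul, hG₁, hG₂, hg₁, hg₂]

/-- The underlying function of a finite sum of modular forms is the sum of the underlying
functions (`ModularForm.coeHom` is additive). [folklore] -/
private theorem coe_finset_sum {Γ : Subgroup (GL (Fin 2) ℝ)} {k : ℤ} {ι : Type*} (s : Finset ι)
    (F : ι → ModularForm Γ k) :
    ((∑ i ∈ s, F i : ModularForm Γ k) : ℍ → ℂ) = ∑ i ∈ s, (F i : ℍ → ℂ) :=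
  map_sum (ModularForm.coeHom (Γ := Γ) (k := k)) F s

/-- `q`-expansion principle at `∞` (uniqueness half, from Mathlib's `hasSum_qExpansion`): two
modular forms of the same weight on arithmetic subgroups `Γ₁, Γ₂ ≤ GL(2, ℝ)` sharing a positive
strict period `h` and having the same `q`-expansion in `e^{2πiτ/h}` are the same function.
[folklore] -/
private theorem coe_eq_of_qExpansion_eq {Γ₁ Γ₂ : Subgroup (GL (Fin 2) ℝ)} [Γ₁.IsArithmetic]
    [Γ₂.IsArithmetic] {k : ℤ} {h : ℝ} (hh : 0 < h) (h₁ : h ∈ Γ₁.strictPeriods)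
    (h₂ : h ∈ Γ₂.strictPeriods) (f₁ : ModularForm Γ₁ k) (f₂ : ModularForm Γ₂ k)
    (he : qExpansion h f₁ = qExpansion h f₂) : (f₁ : ℍ → ℂ) = f₂ := by
  funext τ
  have s₁ := hasSum_qExpansion hh (SlashInvariantFormClass.periodic_comp_ofComplex f₁ h₁)
    (ModularFormClass.holo f₁) (ModularFormClass.bdd_at_infty f₁) τ
  have s₂ := hasSum_qExpansion hh (SlashInvariantFormClass.periodic_comp_ofComplex f₂ h₂)
    (ModularFormClass.holo f₂) (ModularFormClass.bdd_at_infty f₂) τ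
  rw [he] at s₁
  exact s₁.unique s₂

/-- **Remark 59 as a reduction, I: from a decomposition into integral forms.** The
algebraic-integer version `CalegariDimitrovTang2025_unboundedDenominators_algInt` follows from the
base fact `CalegariDimitrovTang2025_unboundedDenominators` (Theorem 1) together with the DESCENT
statement `hdesc` — the printed output of the first steps of Voight's argument (reduction from
`ℤ̄` to `O_K`, Galois conjugates, `f = Σᵢ βᵢ Tr_{K/ℚ}(αᵢ f)`): every weight-`k` modular form on a
finite-index subgroup of `SL(2, ℤ)` with algebraic-integer `q`-expansion coefficients is a finite
`ℂ`-linear combination of weight-`k` modular forms on finite-index subgroups with rational-integer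
coefficients. `hdesc` is an inline hypothesis, deliberately NOT a named fact; it is itself reduced
to the two classical inputs of Remark 59 in
`CalegariDimitrovTang2025_unboundedDenominators_algInt.descent_of_galois`.
The assembly step is `CalegariDimitrovTang2025_unboundedDenominators.conclusion_linearCombination`.
[cite: CalegariDimitrovTang2025, Remark 59 (arXiv:2109.09040 numbering)] -/
theorem CalegariDimitrovTang2025_unboundedDenominators_algInt.of_unboundedDenominators_of_descent
    (hCDT : CalegariDimitrovTang2025_unboundedDenominators)
    (hdesc : ∀ (Γ : Subgroup SL(2, ℤ)) [Γ.FiniteIndex] (k : ℤ)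
      (f : ModularForm (Γ : Subgroup (GL (Fin 2) ℝ)) k) (h : ℕ), 0 < h →
      ((h : ℝ) ∈ (Γ : Subgroup (GL (Fin 2) ℝ)).strictPeriods) →
      (∀ n : ℕ, IsIntegral ℤ (PowerSeries.coeff n (qExpansion (h : ℝ) f))) →
      ∃ (ι : Type) (_ : Fintype ι) (c : ι → ℂ) (Δ : ι → Subgroup SL(2, ℤ))
        (_ : ∀ i, (Δ i).FiniteIndex)
        (g : ∀ i, ModularForm ((Δ i : Subgroup SL(2, ℤ)) : Subgroup (GL (Fin 2) ℝ)) k)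
        (e : ι → ℕ), (∀ i, 0 < e i) ∧
        (∀ i,
          ((e i : ℕ) : ℝ) ∈ ((Δ i : Subgroup SL(2, ℤ)) : Subgroup (GL (Fin 2) ℝ)).strictPeriods) ∧
        (∀ i (n : ℕ), ∃ z : ℤ, PowerSeries.coeff n (qExpansion (e i : ℝ) (g i)) = (z : ℂ)) ∧
        (f : ℍ → ℂ) = ∑ i, c i • (g i : ℍ → ℂ)) :
    CalegariDimitrovTang2025_unboundedDenominators_algInt := by
  intro Γ _ k f h hh hper hint
  obtain ⟨ι, _, c, Δ, hΔ, g, e, he, heper, hgint, hf⟩ := hdesc Γ k f h hh hper hint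
  obtain ⟨Γ', G, hΓ', hG⟩ :=
    CalegariDimitrovTang2025_unboundedDenominators.conclusion_linearCombination hCDT Finset.univ k c
      Δ g e (fun i _ ↦ he i) (fun i _ ↦ heper i) (fun i _ n ↦ hgint i n)
  exact ⟨Γ', G, hΓ', hG.trans hf.symm⟩

open NumberField in
/-- **Remark 59 as a reduction, II: Voight's trace decomposition, proved.** Grant the two
classical inputs of Remark 59, both stated for weight-`k` modular forms on finite-index subgroups
of `SL(2, ℤ)` and their `q`-expansions at a positive strict period `h`, and both taken as inline
hypotheses (deliberately NOT named facts; each needs the algebraic theory of noncongruence modular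
curves, absent from Mathlib):
* `hA` ("since `f(τ)` is a modular form, we are reduced to the situation of a number field `K` such
  that `f(τ) ∈ O_K⟦q^{1/N}⟧`", Remark 58): if all coefficients of `f` are algebraic integers, they
  are the images `σ₀(bₙ)` of integers `bₙ ∈ O_K` of one number field `K` under one embedding
  `σ₀ : K → ℂ`;
* `hB` ("the absolute Galois group `Gal(ℚ̄/ℚ)` acts on the `q`-expansions of modular forms",
  Remark 59): if the coefficients of `f` are `σ₀(bₙ)` with `bₙ ∈ K`, then for every embedding
  `τ : K → ℂ` the series `Σ τ(bₙ) qⁿ` is again the `q`-expansion of a weight-`k` modular form on a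
  finite-index subgroup with strict period `h`.
Then every `f` with algebraic-integer coefficients is a finite `ℂ`-linear combination of weight-`k`
modular forms on finite-index subgroups with rational-integer coefficients — the hypothesis `hdesc`
of `…_algInt.of_unboundedDenominators_of_descent`. Proof as printed: for a `ℤ`-basis `(αᵢ)` of
`O_K` the forms `fᵢ := Σ_τ τ(αᵢ) f^τ` (on the intersection of the levels of the conjugates `f^τ`)
have coefficients `Tr_{K/ℚ}(αᵢ bₙ) ∈ ℤ`, and `f = f^{σ₀} = Σᵢ cᵢ fᵢ` where `c` solves
`Σᵢ cᵢ τ(αᵢ) = δ_{τ,σ₀}` — solvable because `det(τ(αᵢ))² = disc(K) ≠ 0`.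
[cite: CalegariDimitrovTang2025, Remarks 58–59 (arXiv:2109.09040 numbering)] -/
theorem CalegariDimitrovTang2025_unboundedDenominators_algInt.descent_of_galois
    (hA : ∀ (Γ : Subgroup SL(2, ℤ)) [Γ.FiniteIndex] (k : ℤ)
      (f : ModularForm (Γ : Subgroup (GL (Fin 2) ℝ)) k) (h : ℕ), 0 < h →
      ((h : ℝ) ∈ (Γ : Subgroup (GL (Fin 2) ℝ)).strictPeriods) →
      (∀ n : ℕ, IsIntegral ℤ (PowerSeries.coeff n (qExpansion (h : ℝ) f))) →
      ∃ (K : Type) (_ : Field K) (_ : NumberField K) (σ₀ : K →+* ℂ) (b : ℕ → 𝓞 K),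
        ∀ n : ℕ, PowerSeries.coeff n (qExpansion (h : ℝ) f) = σ₀ (b n))
    (hB : ∀ (Γ : Subgroup SL(2, ℤ)) [Γ.FiniteIndex] (k : ℤ)
      (f : ModularForm (Γ : Subgroup (GL (Fin 2) ℝ)) k) (h : ℕ), 0 < h →
      ((h : ℝ) ∈ (Γ : Subgroup (GL (Fin 2) ℝ)).strictPeriods) →
      ∀ (K : Type) [Field K] [NumberField K] (σ₀ : K →+* ℂ) (b : ℕ → K),
      (∀ n : ℕ, PowerSeries.coeff n (qExpansion (h : ℝ) f) = σ₀ (b n)) →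
      ∀ τ : K →+* ℂ, ∃ (Γ' : Subgroup SL(2, ℤ)) (_ : Γ'.FiniteIndex)
        (f' : ModularForm (Γ' : Subgroup (GL (Fin 2) ℝ)) k),
        ((h : ℝ) ∈ (Γ' : Subgroup (GL (Fin 2) ℝ)).strictPeriods) ∧
        ∀ n : ℕ, PowerSeries.coeff n (qExpansion (h : ℝ) f') = τ (b n))
    (Γ : Subgroup SL(2, ℤ)) [Γ.FiniteIndex] (k : ℤ)
    (f : ModularForm (Γ : Subgroup (GL (Fin 2) ℝ)) k) (h : ℕ) (hh : 0 < h)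
    (hper : (h : ℝ) ∈ (Γ : Subgroup (GL (Fin 2) ℝ)).strictPeriods)
    (hint : ∀ n : ℕ, IsIntegral ℤ (PowerSeries.coeff n (qExpansion (h : ℝ) f))) :
    ∃ (ι : Type) (_ : Fintype ι) (c : ι → ℂ) (Δ : ι → Subgroup SL(2, ℤ))
      (_ : ∀ i, (Δ i).FiniteIndex)
      (g : ∀ i, ModularForm ((Δ i : Subgroup SL(2, ℤ)) : Subgroup (GL (Fin 2) ℝ)) k)
      (e : ι → ℕ), (∀ i, 0 < e i) ∧
      (∀ i,
        ((e i : ℕ) : ℝ) ∈ ((Δ i : Subgroup SL(2, ℤ)) : Subgroup (GL (Fin 2) ℝ)).strictPeriods) ∧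
      (∀ i (n : ℕ), ∃ z : ℤ, PowerSeries.coeff n (qExpansion (e i : ℝ) (g i)) = (z : ℂ)) ∧
      (f : ℍ → ℂ) = ∑ i, c i • (g i : ℍ → ℂ) := by
  classical
  have hh' : (0 : ℝ) < h := Nat.cast_pos.mpr hh
  -- Step (i): one number field `K` carries all the coefficients.
  obtain ⟨K, _, _, σ₀, b, hb⟩ := hA Γ k f h hh hper hint
  -- Step (ii): the Galois conjugates `f^σ`, indexed by the `ℚ`-embeddings `σ : K → ℂ`.
  have hB' : ∀ σ : K →ₐ[ℚ] ℂ, ∃ (Γ' : Subgroup SL(2, ℤ)) (_ : Γ'.FiniteIndex)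
      (f' : ModularForm (Γ' : Subgroup (GL (Fin 2) ℝ)) k),
      ((h : ℝ) ∈ (Γ' : Subgroup (GL (Fin 2) ℝ)).strictPeriods) ∧
      ∀ n : ℕ, PowerSeries.coeff n (qExpansion (h : ℝ) f') = σ (b n) := fun σ ↦ by
    simpa using hB Γ k f h hh hper K σ₀ (fun n ↦ (b n : K)) hb (σ : K →+* ℂ)
  choose Λ hΛ fc hperc hcoef using hB'
  -- A common finite-index level for all the conjugates.
  let Γs : Subgroup SL(2, ℤ) := ⨅ σ : K →ₐ[ℚ] ℂ, Λ σ
  haveI hΓs : Γs.FiniteIndex := Subgroup.finiteIndex_iInf hΛ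
  have hle : ∀ σ : K →ₐ[ℚ] ℂ,
      ((Γs : Subgroup SL(2, ℤ)) : Subgroup (GL (Fin 2) ℝ)) ≤ (Λ σ : Subgroup (GL (Fin 2) ℝ)) :=
    fun σ ↦ Subgroup.map_mono (iInf_le _ σ)
  let σ₀' : K →ₐ[ℚ] ℂ := σ₀.toRatAlgHom
  have hpers :
      ((h : ℕ) : ℝ) ∈ ((Γs : Subgroup SL(2, ℤ)) : Subgroup (GL (Fin 2) ℝ)).strictPeriods := by
    have h0 := hperc σ₀'
    rw [Subgroup.mem_strictPeriods_iff] at h0 ⊢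
    obtain ⟨A, hA0, hAeq⟩ := Subgroup.mem_map.mp h0
    refine Subgroup.mem_map.mpr ⟨A, Subgroup.mem_iInf.mpr fun σ ↦ ?_, hAeq⟩
    have hσ := hperc σ
    rw [Subgroup.mem_strictPeriods_iff] at hσ
    obtain ⟨B, hB0, hBeq⟩ := Subgroup.mem_map.mp hσ
    obtain rfl : B = A := Matrix.SpecialLinearGroup.mapGL_injective (hBeq.trans hAeq.symm)
    exact hB0
  -- The conjugates, restricted to the common level.
  choose F hF using fun σ : K →ₐ[ℚ] ℂ ↦ exists_modularForm_of_le (hle σ) k (fc σ)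
  have hFq : ∀ (σ : K →ₐ[ℚ] ℂ) (n : ℕ),
      PowerSeries.coeff n (qExpansion (h : ℝ) (F σ)) = σ (b n) := fun σ n ↦ by
    rw [hF σ, hcoef σ n]
  -- A `ℤ`-basis `α` of `O_K` and the trace forms `g i = Σ_σ σ(α i) • f^σ`.
  let ι : Type := Module.Free.ChooseBasisIndex ℤ (𝓞 K)
  let α : ι → K := fun i ↦ integralBasis K i
  let g : ι → ModularForm ((Γs : Subgroup SL(2, ℤ)) : Subgroup (GL (Fin 2) ℝ)) k :=
    fun i ↦ ∑ σ : K →ₐ[ℚ] ℂ, (σ (α i)) • F σ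
  have hg_coe : ∀ i, (g i : ℍ → ℂ) = ∑ σ : K →ₐ[ℚ] ℂ, (σ (α i)) • (F σ : ℍ → ℂ) := fun i ↦ by
    simp only [g, coe_finset_sum, ModularForm.IsGLPos.coe_smul]
  have hg_q : ∀ (i : ι) (n : ℕ),
      PowerSeries.coeff n (qExpansion (h : ℝ) (g i)) = ∑ σ : K →ₐ[ℚ] ℂ, σ (α i * b n) := by
    intro i n
    have hq : qExpansion (h : ℝ) (g i) =
        ∑ σ : K →ₐ[ℚ] ℂ, (σ (α i)) • qExpansion (h : ℝ) (F σ) := by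
      change ModularForm.qExpansionAddHom hh' hpers k (g i) = _
      simp only [g, map_sum]
      refine Finset.sum_congr rfl fun σ _ ↦ ?_
      change qExpansion (h : ℝ) ⇑((σ (α i)) • F σ) = _
      rw [ModularForm.IsGLPos.coe_smul]
      exact ModularForm.qExpansion_smul hh' hpers _ (F σ)
    rw [hq, map_sum]
    refine Finset.sum_congr rfl fun σ _ ↦ ?_
    rw [map_smul, hFq σ n, smul_eq_mul, map_mul]
  have hg_int : ∀ (i : ι) (n : ℕ),
      ∃ z : ℤ, PowerSeries.coeff n (qExpansion (h : ℝ) (g i)) = (z : ℂ) := by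
    intro i n
    have hx : IsIntegral ℤ (α i * (b n : K)) := by
      simp only [α, integralBasis_apply]
      exact (RingOfIntegers.isIntegral_coe (RingOfIntegers.basis K i)).mul
        (RingOfIntegers.isIntegral_coe (b n))
    obtain ⟨z, hz⟩ := IsIntegrallyClosed.isIntegral_iff.mp (Algebra.isIntegral_trace (L := ℚ) hx)
    refine ⟨z, ?_⟩
    rw [hg_q, ← trace_eq_sum_embeddings ℂ (K := ℚ) (L := K), ← hz]
    simp
  -- The coefficient vector: `Σ_i c_i σ(α i) = δ_{σ, σ₀}`, from `det (σ_j (α_i)) ≠ 0`.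
  have hcard : Fintype.card ι = Fintype.card (K →ₐ[ℚ] ℂ) := by
    rw [AlgHom.card ℚ K ℂ, ← RingOfIntegers.rank K, Module.finrank_eq_card_chooseBasisIndex]
  let e : ι ≃ (K →ₐ[ℚ] ℂ) := Fintype.equivOfCardEq hcard
  let M : Matrix ι ι ℂ := Algebra.embeddingsMatrixReindex ℚ ℂ α e
  have hM : ∀ i j, M i j = e j (α i) := fun i j ↦ rfl
  have hdet : IsUnit M.det := by
    have h2 : M.det ^ 2 ≠ 0 := by
      have := Algebra.discr_eq_det_embeddingsMatrixReindex_pow_two ℚ ℂ (integralBasis K) e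
      rw [show (⇑(integralBasis K) : ι → K) = α from rfl] at this
      rw [← this]
      exact (map_ne_zero (algebraMap ℚ ℂ)).mpr (Algebra.discr_not_zero_of_basis ℚ (integralBasis K))
    exact isUnit_iff_ne_zero.mpr fun h0 ↦ h2 (by rw [h0, zero_pow two_ne_zero])
  let δ : ι → ℂ := Pi.single (e.symm σ₀') (1 : ℂ)
  let cvec : ι → ℂ := Matrix.vecMul δ M⁻¹
  have hc : Matrix.vecMul cvec M = δ := by
    simp only [cvec, Matrix.vecMul_vecMul, Matrix.nonsing_inv_mul _ hdet, Matrix.vecMul_one]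
  have hcσ : ∀ σ : K →ₐ[ℚ] ℂ, ∑ i, cvec i * σ (α i) = if σ = σ₀' then 1 else 0 := by
    intro σ
    have := congrFun hc (e.symm σ)
    simp only [Matrix.vecMul, dotProduct, hM, Equiv.apply_symm_apply, δ, Pi.single_apply,
      Equiv.apply_eq_iff_eq] at this
    exact this
  -- Assembly: `f = f^{σ₀} = Σ_σ δ_{σ,σ₀} f^σ = Σ_i c_i g_i`.
  have hf0 : (f : ℍ → ℂ) = F σ₀' := by
    refine coe_eq_of_qExpansion_eq hh' hper hpers f (F σ₀') (PowerSeries.ext fun n ↦ ?_)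
    rw [hFq σ₀' n, hb n]
    simp [σ₀']
  refine ⟨ι, inferInstance, cvec, fun _ ↦ Γs, fun _ ↦ hΓs, g, fun _ ↦ h, fun _ ↦ hh,
    fun _ ↦ hpers, hg_int, ?_⟩
  calc (f : ℍ → ℂ) = ∑ σ : K →ₐ[ℚ] ℂ, (if σ = σ₀' then (1 : ℂ) else 0) • (F σ : ℍ → ℂ) := by
        rw [hf0]
        simp only [ite_smul, one_smul, zero_smul, Finset.sum_ite_eq', Finset.mem_univ, if_true]
    _ = ∑ σ : K →ₐ[ℚ] ℂ, (∑ i, cvec i * σ (α i)) • (F σ : ℍ → ℂ) := by simp only [hcσ]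
    _ = ∑ i, cvec i • (g i : ℍ → ℂ) := by
        simp only [hg_coe, Finset.smul_sum, Finset.sum_smul, smul_smul]
        rw [Finset.sum_comm]

open NumberField in
/-- **Remark 59, assembled.** The algebraic-integer version
`CalegariDimitrovTang2025_unboundedDenominators_algInt` follows from the base fact
`CalegariDimitrovTang2025_unboundedDenominators` (Theorem 1) and the two classical inputs `hA`
(one number field carries all coefficients — Remark 58) and `hB` (Galois conjugates of modular
forms on finite-index subgroups are modular — Remark 59), everything else (Voight's trace
decomposition, and the intersection of the resulting congruence levels) being proved here. `hA`
and `hB` are inline hypotheses, deliberately NOT named facts (D-0026): once they and Theorem 1 are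
available as theorems, this closes the fact.
[cite: CalegariDimitrovTang2025, Remarks 58–59 (arXiv:2109.09040 numbering)] -/
theorem CalegariDimitrovTang2025_unboundedDenominators_algInt.of_unboundedDenominators_of_galois
    (hCDT : CalegariDimitrovTang2025_unboundedDenominators)
    (hA : ∀ (Γ : Subgroup SL(2, ℤ)) [Γ.FiniteIndex] (k : ℤ)
      (f : ModularForm (Γ : Subgroup (GL (Fin 2) ℝ)) k) (h : ℕ), 0 < h →
      ((h : ℝ) ∈ (Γ : Subgroup (GL (Fin 2) ℝ)).strictPeriods) →
      (∀ n : ℕ, IsIntegral ℤ (PowerSeries.coeff n (qExpansion (h : ℝ) f))) →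
      ∃ (K : Type) (_ : Field K) (_ : NumberField K) (σ₀ : K →+* ℂ) (b : ℕ → 𝓞 K),
        ∀ n : ℕ, PowerSeries.coeff n (qExpansion (h : ℝ) f) = σ₀ (b n))
    (hB : ∀ (Γ : Subgroup SL(2, ℤ)) [Γ.FiniteIndex] (k : ℤ)
      (f : ModularForm (Γ : Subgroup (GL (Fin 2) ℝ)) k) (h : ℕ), 0 < h →
      ((h : ℝ) ∈ (Γ : Subgroup (GL (Fin 2) ℝ)).strictPeriods) →
      ∀ (K : Type) [Field K] [NumberField K] (σ₀ : K →+* ℂ) (b : ℕ → K),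
      (∀ n : ℕ, PowerSeries.coeff n (qExpansion (h : ℝ) f) = σ₀ (b n)) →
      ∀ τ : K →+* ℂ, ∃ (Γ' : Subgroup SL(2, ℤ)) (_ : Γ'.FiniteIndex)
        (f' : ModularForm (Γ' : Subgroup (GL (Fin 2) ℝ)) k),
        ((h : ℝ) ∈ (Γ' : Subgroup (GL (Fin 2) ℝ)).strictPeriods) ∧
        ∀ n : ℕ, PowerSeries.coeff n (qExpansion (h : ℝ) f') = τ (b n)) :
    CalegariDimitrovTang2025_unboundedDenominators_algInt :=
  CalegariDimitrovTang2025_unboundedDenominators_algInt.of_unboundedDenominators_of_descent hCDT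
    fun Γ _ k f h hh hper hint ↦
      CalegariDimitrovTang2025_unboundedDenominators_algInt.descent_of_galois hA hB Γ k f h hh
        hper hint

/-- **Algebraic-integer version in non-positive weight** (settled outright, exactly as for the base
fact): in weight `k ≤ 0` a modular form on a finite-index `Γ ≤ SL(2, ℤ)` is zero (`k < 0`) or
constant (`k = 0`), hence modular of weight `k` for `Γ(1)`; the integrality hypothesis is not used.
[cite: CalegariDimitrovTang2025, Theorem 1 and Remark 58 (arXiv:2109.09040 numbering)] -/
theorem CalegariDimitrovTang2025_unboundedDenominators_algInt.of_weight_nonpos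
    (Γ : Subgroup SL(2, ℤ)) [Γ.FiniteIndex] (k : ℤ) (hk : k ≤ 0)
    (f : ModularForm (Γ : Subgroup (GL (Fin 2) ℝ)) k) (h : ℕ) (_hh : 0 < h)
    (_hper : (h : ℝ) ∈ (Γ : Subgroup (GL (Fin 2) ℝ)).strictPeriods)
    (_hint : ∀ n : ℕ, IsIntegral ℤ (PowerSeries.coeff n (qExpansion (h : ℝ) f))) :
    ∃ (Γ' : Subgroup SL(2, ℤ)) (g : ModularForm (Γ' : Subgroup (GL (Fin 2) ℝ)) k),
      IsCongruenceSubgroup Γ' ∧ (g : ℍ → ℂ) = f := by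
  obtain rfl | hk' := hk.eq_or_lt
  · exact CalegariDimitrovTang2025_unboundedDenominators.conclusion_of_weight_zero Γ f
  · exact CalegariDimitrovTang2025_unboundedDenominators.conclusion_of_weight_neg Γ hk' f

/-- **Reduction of the algebraic-integer version to positive weight.** The named fact
`CalegariDimitrovTang2025_unboundedDenominators_algInt` follows from its restriction to weights
`k ≥ 1` (weights `k ≤ 0` being settled by `…_algInt.of_weight_nonpos`); the restriction is taken as
the inline hypothesis `hpos`, deliberately NOT a new named fact.
[cite: CalegariDimitrovTang2025, Theorem 1, §6.3 and Remark 58 (arXiv:2109.09040 numbering)] -/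
theorem CalegariDimitrovTang2025_unboundedDenominators_algInt.of_pos_weight_case
    (hpos : ∀ (Γ : Subgroup SL(2, ℤ)) [Γ.FiniteIndex] (k : ℤ), 1 ≤ k →
      ∀ (f : ModularForm (Γ : Subgroup (GL (Fin 2) ℝ)) k) (h : ℕ), 0 < h →
      ((h : ℝ) ∈ (Γ : Subgroup (GL (Fin 2) ℝ)).strictPeriods) →
      (∀ n : ℕ, IsIntegral ℤ (PowerSeries.coeff n (qExpansion (h : ℝ) f))) →
      ∃ (Γ' : Subgroup SL(2, ℤ)) (g : ModularForm (Γ' : Subgroup (GL (Fin 2) ℝ)) k),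
        IsCongruenceSubgroup Γ' ∧ (g : ℍ → ℂ) = f) :
    CalegariDimitrovTang2025_unboundedDenominators_algInt := by
  intro Γ _ k f h hh hper hint
  rcases le_or_gt k 0 with hk | hk
  · exact CalegariDimitrovTang2025_unboundedDenominators_algInt.of_weight_nonpos Γ k hk f h hh hper
      hint
  · exact hpos Γ k hk f h hh hper hint

end Literature.NumberTheory.Automorphic

end
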